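import Literature.NumberTheory.IwasawaTheory.ClassicalMuVanishesOddCharacterLayer
import Mathlib.RingTheory.ZMod.UnitsCyclic
import Mathlib.FieldTheory.Galois.Abelian
import HarnessLib

set_option autoImplicit false

/-!
# `μ_p(L) = 0` for an abelian CM field `L ∋ ζ_p` from `μ_p = 0` of its IMAGINARY CYCLIC subfields alone — consumer forms of the
# odd-character reflection descent (theorem-only; no named fact, no `sorry`)

Topic `NumberTheory/IwasawaTheory` (namespace = path).  THEOREM-ONLY file written by the prover seat `bsd-potss-rkm` (generation 37,
cell `bsd-potss`; `--supports` stmt-BirchSwinnertonDyer-19196, crux M `ReducibleKatoMember` of the routes K9 / K8-t′; closes nothing).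
`ClassicalMuVanishesOddCharacterLayer.lean` proves, for `G` finite commutative of exponent dividing `p − 1` acting through
`t : G → Gal(L/F)`, that `μ = 0` for `L` follows from `μ = 0` for the fixed fields `L^{t(ker χ)}` of the ODD characters `χ` of `G`.
This file specialises to `G = Gal(L/F)` itself (commutative of exponent dividing `p − 1`) and rephrases the input WITHOUT characters:

  **(‡) `μ_p = 0` for every cyclotomic `ℤ_p`-extension of every intermediate field `F ⊆ M ⊆ L` with `Gal(M/F)` CYCLIC and `M` NOT
  totally real ⟹ `μ_p = 0` for every cyclotomic `ℤ_p`-extension of `L`**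

(`classicalMuVanishes_of_isCyclotomic_of_imaginaryCyclicSubfields`; for an odd `χ`, `M = L^{ker χ}` has `Gal(M/F) ≅ G/ker χ ↪ 𝔽_pˣ`
cyclic, and is not totally real because the complex conjugation `z ∉ ker χ` — a totally real `M` lies in `L⁺ = L^{⟨z⟩}`).  Over
`F = ℚ` (`classicalMuVanishes_of_isCyclotomic_of_imaginaryCyclicSubfields_rat`) the CM structure is automatic for a totally complex
ABELIAN field (Mathlib `IsCMField.of_isAbelianGalois`), so the statement needs only `[IsAbelianGalois ℚ L]`, `IsTotallyComplex L`,
`ζ_p ∈ L` and `exp Gal(L/ℚ) ∣ p − 1`: **Ferrero–Washington for `L` reduces, in the kernel, to Ferrero–Washington for the IMAGINARY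
CYCLIC subfields of `L`** (for `p = 3`, `L = ℚ(√d, √−3)`: to `ℚ(√−3)` and `ℚ(√−3d)` — generation 36; for `p = 5`, `L = ℚ(ζ₅, √d)`:
to `ℚ(ζ₅)` and `ℚ(√d), ℚ(√5d)` (`d < 0`) or the cyclic quartic `ℚ(ωψ_d)` (`d > 0`)).

## What is NOT here (honest scope)

No `p`-adic `L`-function, no `μ⁻ = 0`; nothing about elliptic curves (the Borel-field consumer lives in `Summits/…/Theorems/`).
BSD is advanced for no curve by this file.

## References

* L. C. Washington, *Introduction to Cyclotomic Fields*, 2nd ed., GTM 83 (1997): §7.5 (proof of Ferrero–Washington: reduction to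
  `μ(L_p(s, χ)) = 0` for odd `χ`), §10.2, §13.3 Prop. 13.23, Ch. 4 (CM fields). [Washington1997]
* S. Lang, *Cyclotomic Fields I and II*, GTM 121 (1990), Ch. 13 §2, Thm. 2.1 (i). [Lang1990]
* Tree: `IwasawaTheory/ClassicalMuVanishesOddCharacterLayer.lean`, `NumberFields/ClassGroupMinusPartOddCharacters.lean` (g37);
  Mathlib `FieldTheory/Galois/Abelian`, `NumberTheory/NumberField/CMField`, `RingTheory/ZMod/UnitsCyclic`.
-/

noncomputable section

open scoped NumberField

open Field IntermediateField NumberField NumberField.InfinitePlace NumberField.IsCMField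
  Literature.NumberTheory.GaloisRepresentations Literature.NumberTheory.EllipticCurves
  Literature.NumberTheory.EllipticCurves.ZpExtension Literature.NumberTheory.NumberFields

namespace Literature.NumberTheory.IwasawaTheory

section Consumer

variable {F : Type} [Field F] [NumberField F] {p : ℕ} [hp : Fact p.Prime]

/-- `p ∤ #G` for a finite group of exponent dividing `p − 1` (Cauchy). [folklore] -/
private theorem not_dvd_natCard_of_exponent_dvd'' {G : Type*} [Group G] [Finite G] (hG : Monoid.exponent G ∣ p - 1) :
    ¬ p ∣ Nat.card G := by
  intro h
  haveI := Fintype.ofFinite G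
  rw [Nat.card_eq_fintype_card] at h
  obtain ⟨g, hg⟩ := exists_prime_orderOf_dvd_card p h
  have h1 : orderOf g ∣ p - 1 := (Monoid.order_dvd_exponent g).trans hG
  rw [hg] at h1
  have h2 := Nat.le_of_dvd (Nat.sub_pos_of_lt hp.out.one_lt) h1
  have h3 := hp.out.one_lt
  omega

omit [NumberField F] in
/-- **`Gal(L^{ker χ}/F)` is cyclic** for a character `χ : Gal(L/F) → 𝔽_pˣ` (`L/F` finite Galois): it is a quotient of
`Gal(L/F)/ker χ ≅ χ(Gal(L/F)) ≤ 𝔽_pˣ`, a subgroup of a cyclic group. [cite: Washington1997, §3 (the field `ℚ(χ)` belonging to a character: `Gal(ℚ(χ)/ℚ) ≅ Gal/ker χ`)] -/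
theorem isCyclic_gal_fixedField_ker {L : Type} [Field L] [Algebra F L] [FiniteDimensional F L] [IsGalois F L]
    (χ : (L ≃ₐ[F] L) →* (ZMod p)ˣ) :
    IsCyclic (↥(fixedField χ.ker) ≃ₐ[F] ↥(fixedField χ.ker)) := by
  set M : IntermediateField F L := fixedField χ.ker with hM
  haveI : IsGalois F ↥M := by
    haveI : χ.ker.Normal := inferInstance
    exact IsGalois.of_fixedField_normal_subgroup χ.ker
  -- `Gal(L/F)/ker χ → Gal(M/F)`, onto
  have hle : χ.ker ≤ (AlgEquiv.restrictNormalHom ↥M).ker := by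
    intro g hg
    rw [IntermediateField.restrictNormalHom_ker, IntermediateField.mem_fixingSubgroup_iff]
    intro x hx
    exact (mem_fixedField_iff χ.ker x).mp hx g hg
  let f : (L ≃ₐ[F] L) ⧸ χ.ker →* (↥M ≃ₐ[F] ↥M) := QuotientGroup.lift χ.ker (AlgEquiv.restrictNormalHom ↥M) hle
  have hf : Function.Surjective f := by
    intro σ
    obtain ⟨g, rfl⟩ := AlgEquiv.restrictNormalHom_surjective L σ
    exact ⟨QuotientGroup.mk g, rfl⟩
  haveI : IsCyclic χ.range := Subgroup.isCyclic _
  haveI : IsCyclic ((L ≃ₐ[F] L) ⧸ χ.ker) :=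
    isCyclic_of_surjective (QuotientGroup.quotientKerEquivRange χ).symm (QuotientGroup.quotientKerEquivRange χ).symm.surjective
  exact isCyclic_of_surjective f hf

/-- **`L^{ker χ}` is NOT totally real for an ODD character `χ`** (`χ(z) ≠ 1`, `z` the complex conjugation of the CM field `L`, i.e. an
involution of `Gal(L/F)` with totally real fixed field): a totally real subfield lies in `L⁺ = L^{⟨z⟩}` (Mathlib
`IsTotallyReal.le_maximalRealSubfield`, and `complexConj L = z` by `complexConj_apply_eq_of_isTotallyReal_fixedField`), so `z` would fix
it, i.e. `z ∈ ker χ`. [cite: Washington1997, Ch. 4 (CM fields), §7.5 (odd characters ↔ imaginary fields)] -/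
theorem not_isTotallyReal_fixedField_ker_of_apply_ne_one {L : Type} [Field L] [NumberField L] [Algebra F L] [IsGalois F L]
    [IsTotallyComplex L] {z : L ≃ₐ[F] L} (hz : z * z = 1) (hz1 : z ≠ 1) (hreal : IsTotallyReal ↥(fixedField (Subgroup.zpowers z)))
    (χ : (L ≃ₐ[F] L) →* (ZMod p)ˣ) (hχ : χ z ≠ 1) :
    ¬ IsTotallyReal ↥(fixedField χ.ker) := by
  intro hTR
  haveI : FiniteDimensional F L := Module.Finite.of_restrictScalars_finite ℚ F L
  -- the CM structure of `L` with `L⁺ = L^{⟨z⟩}`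
  set F₀ : IntermediateField F L := fixedField (Subgroup.zpowers z) with hF₀
  haveI : IsTotallyReal ↥F₀ := hreal
  have horder : orderOf z = 2 := orderOf_eq_prime (by rw [pow_two, hz]) hz1
  haveI : Algebra.IsQuadraticExtension ↥F₀ L :=
    { toFree := Module.Free.of_divisionRing ↥F₀ L
      finrank_eq_two' := by rw [hF₀, finrank_fixedField_eq_card, Nat.card_zpowers, horder] }
  haveI : IsCMField L := IsCMField.ofCMExtension ↥F₀ L
  -- a totally real subfield lies in `L⁺`, fixed by `complexConj L = z`
  haveI : IsTotallyReal ↥(fixedField χ.ker).toSubfield := IsTotallyReal.ofRingEquiv (RingEquiv.refl ↥(fixedField χ.ker))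
  have hle : (fixedField χ.ker).toSubfield ≤ maximalRealSubfield L := IsTotallyReal.le_maximalRealSubfield _
  have hzfix : z ∈ IntermediateField.fixingSubgroup (fixedField χ.ker) := by
    rw [IntermediateField.mem_fixingSubgroup_iff]
    intro x hx
    rw [← complexConj_apply_eq_of_isTotallyReal_fixedField z hz1 hz hreal x]
    exact (complexConj_eq_self_iff L x).mpr (hle (show x ∈ (fixedField χ.ker).toSubfield from hx))
  rw [fixingSubgroup_fixedField] at hzfix
  exact hχ (MonoidHom.mem_ker.mp hzfix)

/-- **`μ_p(L) = 0` FROM `μ_p = 0` OF THE IMAGINARY CYCLIC SUBFIELDS ALONE.**  `F` totally real, `p` an odd prime, `L/F` finite Galois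
with `Gal(L/F)` COMMUTATIVE of exponent dividing `p − 1`, `L` totally complex containing a primitive `p`-th root of unity, `z ∈ Gal(L/F)`
an involution `≠ 1` with `L^{⟨z⟩}` totally real (`L` is CM).  If `μ = 0` (growth form) holds for every cyclotomic `ℤ_p`-extension of
every intermediate field `F ⊆ M ⊆ L` with `Gal(M/F)` CYCLIC and `M` NOT totally real, then it holds for every cyclotomic `ℤ_p`-extension
of `L`.  (The odd characters `χ` of `Gal(L/F)` give exactly such `M = L^{ker χ}`: `isCyclic_gal_fixedField_ker`,
`not_isTotallyReal_fixedField_ker_of_apply_ne_one`; then `classicalMuVanishes_of_isCyclotomic_of_oddCharacters` with `t = id`.)  The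
even/real subfields — in particular `L⁺` and `L` itself when `Gal(L/F)` is not cyclic — are NOT inputs.
[cite: Washington1997, §7.5 (Ferrero–Washington: reduction to odd characters), §10.2, §13.3 Prop. 13.23] [cite: Lang1990, Ch. 13 §2, Thm. 2.1 (i)] -/
theorem classicalMuVanishes_of_isCyclotomic_of_imaginaryCyclicSubfields [IsTotallyReal F] (hp2 : p ≠ 2) (L : Type)
    [Field L] [NumberField L] [Algebra F L] [IsGalois F L] [IsMulCommutative (L ≃ₐ[F] L)] [IsTotallyComplex L]
    {ζ : L} (hζ : IsPrimitiveRoot ζ p) (hexp : Monoid.exponent (L ≃ₐ[F] L) ∣ p - 1)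
    {z : L ≃ₐ[F] L} (hz : z * z = 1) (hz1 : z ≠ 1) (hreal : IsTotallyReal ↥(fixedField (Subgroup.zpowers z)))
    (hμ : ∀ M : IntermediateField F L, IsCyclic (↥M ≃ₐ[F] ↥M) → ¬ IsTotallyReal ↥M →
      ∀ κM : ZpExtension ↥M p, κM.IsCyclotomic → ClassicalMuVanishes κM)
    (κL : ZpExtension L p) (hκL : κL.IsCyclotomic) : ClassicalMuVanishes κL := by
  open scoped IsMulCommutative in
  classical
  haveI : FiniteDimensional F L := Module.Finite.of_restrictScalars_finite ℚ F L
  letI : Fintype ((L ≃ₐ[F] L) →* (ZMod p)ˣ) := Fintype.ofFinite _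
  have hpL : ¬ p ∣ Module.finrank F L := by
    rw [← IsGalois.card_aut_eq_finrank]
    exact not_dvd_natCard_of_exponent_dvd'' hexp
  refine classicalMuVanishes_of_isCyclotomic_of_oddCharacters hp2 L hpL hζ (G := L ≃ₐ[F] L) hexp (MonoidHom.id _)
    (z := z) hz hz1 hreal (fun χ hχ κE hκE => ?_) κL hκL
  have hmap : (χ.ker).map (MonoidHom.id (L ≃ₐ[F] L)) = χ.ker := Subgroup.map_id _
  have e : ↥(fixedField χ.ker) ≃ₐ[F] ↥(fixedField ((χ.ker).map (MonoidHom.id (L ≃ₐ[F] L)))) :=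
    IntermediateField.equivOfEq (congrArg fixedField hmap.symm)
  have hpM : ¬ p ∣ Module.finrank F ↥(fixedField χ.ker) := fun h =>
    hpL (h.trans (Dvd.intro _ (Module.finrank_mul_finrank F ↥(fixedField χ.ker) L)))
  exact forall_classicalMuVanishes_of_algEquiv e hpM
    (hμ (fixedField χ.ker) (isCyclic_gal_fixedField_ker χ) (not_isTotallyReal_fixedField_ker_of_apply_ne_one hz hz1 hreal χ hχ))
    κE hκE

/-- **OVER `ℚ`: `μ_p(L) = 0` for a totally complex ABELIAN field `L ∋ ζ_p` with `exp Gal(L/ℚ) ∣ p − 1`, from `μ_p = 0` of its imaginary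
cyclic subfields alone.**  `L` is CM (Mathlib `IsCMField.of_isAbelianGalois`); `z` = the complex conjugation, `L^{⟨z⟩} = L⁺`.  So the
FERRERO–WASHINGTON INPUT FOR `L` REDUCES, IN THE KERNEL, TO FERRERO–WASHINGTON FOR THE IMAGINARY CYCLIC SUBFIELDS `M ⊆ L`
(`μ(L_p(s, ψ)) = 0` for the odd characters `ψ`, in Iwasawa's analytic language).  Examples: `p = 3`, `L = ℚ(√d, √−3)`: `M ∈ {ℚ(√−3),
ℚ(√−3d)}` (generation 36); `p = 5`, `L = ℚ(ζ₅, √d)`: `M ∈ {ℚ(ζ₅), ℚ(√−5·…)}` — `ℚ(ζ₅)`, and `ℚ(√d), ℚ(√5d)` if `d < 0`, the cyclic quartic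
field of `ωψ_d` if `d > 0`. [cite: Washington1997, §7.5, §10.2, §13.3 Prop. 13.23, Ch. 4] [cite: Lang1990, Ch. 13 §2, Thm. 2.1 (i)] -/
theorem classicalMuVanishes_of_isCyclotomic_of_imaginaryCyclicSubfields_rat (hp2 : p ≠ 2) (L : Type) [Field L]
    [NumberField L] [IsAbelianGalois ℚ L] [IsTotallyComplex L] {ζ : L} (hζ : IsPrimitiveRoot ζ p)
    (hexp : Monoid.exponent (L ≃ₐ[ℚ] L) ∣ p - 1)
    (hμ : ∀ M : IntermediateField ℚ L, IsCyclic (↥M ≃ₐ[ℚ] ↥M) → ¬ IsTotallyReal ↥M →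
      ∀ κM : ZpExtension ↥M p, κM.IsCyclotomic → ClassicalMuVanishes κM)
    (κL : ZpExtension L p) (hκL : κL.IsCyclotomic) : ClassicalMuVanishes κL := by
  haveI : FiniteDimensional ℚ L := Module.Finite.of_restrictScalars_finite ℚ ℚ L
  -- the complex conjugation as a `ℚ`-automorphism
  let z : L ≃ₐ[ℚ] L := (complexConj L).restrictScalars ℚ
  have hzap : ∀ x, z x = complexConj L x := fun _ => rfl
  have hz : z * z = 1 := by
    ext x
    rw [AlgEquiv.mul_apply, hzap, hzap, complexConj_apply_apply, AlgEquiv.one_apply]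
  have hz1 : z ≠ 1 := by
    intro h
    apply complexConj_ne_one L
    ext x
    have := congrArg (fun f : L ≃ₐ[ℚ] L => f x) h
    simp only [hzap, AlgEquiv.one_apply] at this
    rw [AlgEquiv.one_apply]
    exact this
  -- `L^{⟨z⟩} = L⁺` is totally real
  have hmem : ∀ x : L, x ∈ fixedField (Subgroup.zpowers z) ↔ x ∈ maximalRealSubfield L := by
    intro x
    rw [← complexConj_eq_self_iff L x, mem_fixedField_iff]
    constructor
    · intro h
      exact (hzap x) ▸ h z (Subgroup.mem_zpowers z)
    · intro h g hg
      obtain ⟨k, rfl⟩ := Subgroup.mem_zpowers_iff.mp hg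
      have hzx : z x = x := by rw [hzap]; exact h
      have hzsx : z.symm x = x := by
        rw [AlgEquiv.symm_apply_eq]; exact hzx.symm
      -- `z^k x = x` for all integers `k`
      have hnat : ∀ n : ℕ, (z ^ n) x = x := by
        intro n
        induction n with
        | zero => rw [pow_zero, AlgEquiv.one_apply]
        | succ n ih => rw [pow_succ, AlgEquiv.mul_apply, hzx, ih]
      obtain ⟨n, rfl | rfl⟩ := Int.eq_nat_or_neg k
      · rw [zpow_natCast]; exact hnat n
      · rw [zpow_neg, zpow_natCast]
        have h2 : (z ^ n) x = x := hnat n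
        calc (z ^ n)⁻¹ x = (z ^ n)⁻¹ ((z ^ n) x) := by rw [h2]
          _ = x := by rw [← AlgEquiv.mul_apply, inv_mul_cancel, AlgEquiv.one_apply]
  let e : ↥(fixedField (Subgroup.zpowers z)) ≃+* ↥(maximalRealSubfield L) :=
    { toFun := fun x => ⟨x.1, (hmem x.1).mp x.2⟩
      invFun := fun x => ⟨x.1, (hmem x.1).mpr x.2⟩
      left_inv := fun x => rfl
      right_inv := fun x => rfl
      map_mul' := fun x y => rfl
      map_add' := fun x y => rfl }
  have hreal : IsTotallyReal ↥(fixedField (Subgroup.zpowers z)) := IsTotallyReal.ofRingEquiv e.symm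
  exact classicalMuVanishes_of_isCyclotomic_of_imaginaryCyclicSubfields (F := ℚ) hp2 L hζ hexp hz hz1 hreal hμ κL hκL

end Consumer

end Literature.NumberTheory.IwasawaTheory

end
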